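import Mathlib
import Literature.Computability.AutomaticStructures.AutomaticBlock
import Summits.MatrixMultiplication.MatrixMultiplication.Theses.AutomaticSTPPDesigns
import Summits.MatrixMultiplication.MatrixMultiplication.Theorems.AutomaticSTPPDesignsBlockTensorTransferKStar
import Summits.MatrixMultiplication.MatrixMultiplication.Theorems.AutomaticSTPPDesignsBlockTensorTransferBlocks

/-!
# `BlockTensorTransfer` (route AutomaticSTPPDesigns, support item stmt-MatrixMultiplication-7361)

**Theorem.** Every finite STPP design `(A i, B i, C i)_{i < n}` in `ZMod N` (`N ≥ 1`, route predicate
`IsSTPP`) whose packing sum at exponent `τ > 0` exceeds `3 p N` yields, for that base `p ≥ 2`, three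
REGULAR languages over `Fin n × Fin p` whose all-scale block family (the route's `blk`, i.e.
`Literature.Computability.AutomaticStructures.automaticBlock`) is an STPP family in every
`ZMod (p^k)` and beats `p^k` at exponent `τ` at infinitely many scales.

**Proof** (the planner's block-tensor construction, carry-free). Let `K` be least with `3 N ≤ p^K`;
then `K ≥ 1` and `p^K < 3 p N < ∑_i (|A i| |B i| |C i|)^τ`. Code `s : ZMod N` by the `K` base-`p`
digits of its representative in `[0, N)` and let `L_D` (`D = A, B, C`) be the Kleene star of the block
words `(i, digit₀ s) ⋯ (i, digit_{K-1} s)`, `s ∈ D i` — regular as the star of a uniform-length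
language (`isRegular_kstar_of_length_eq`, Myhill–Nerode). At a scale `k ∉ Kℕ` all blocks are
empty; at scale `m K` the blocks over block-constant index words are the `m`-fold product design
embedded by `(s_t) ↦ ∑_t s_t p^(K t)`, no carry crosses a block because an STPP relation has block
combinations of absolute value `≤ 3 (N - 1) < p^K`, so the design's STPP transfers
(`addSimultaneousTPP_automaticBlock_blockLang`, CKSU 2005 Lemma 5.4), and the packing sum is
`≥ (∑_i x_i^τ)^m > p^(m K)` for `m ≥ 1` (`pow_sum_rpow_le_sum_automaticBlock_blockLang`).
-/

-- the tree's namespace `Summit.MatrixMultiplication.MatrixMultiplication.…` repeats a component by design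
set_option linter.dupNamespace false

namespace Summit.MatrixMultiplication.MatrixMultiplication.Theorems

open scoped Computability
open Finset Literature.Computability.AutomaticStructures BlockTensorTransfer

/-- **`BlockTensorTransfer` holds**: every finite STPP design in `ZMod N` with
`∑_i (|A i| |B i| |C i|)^τ > 3 p N` block-tensors, carry-free, into a regular all-scale STPP family
in the `ZMod (p^k)` tower beating `p^k` at exponent `τ` at infinitely many scales (all scales
`(k₀ + 1) K`). -/
theorem blockTensorTransfer_proof :
    Summit.MatrixMultiplication.MatrixMultiplication.Theses.AutomaticSTPPDesigns.BlockTensorTransfer := by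
  intro N n A B C hN1 hS p hp τ hτ hsum
  classical
  haveI : NeZero N := ⟨by omega⟩
  haveI : NeZero p := ⟨by omega⟩
  -- the block length `K`: least with `3 N ≤ p ^ K`
  have hex : ∃ K : ℕ, 3 * N ≤ p ^ K := ⟨3 * N, (Nat.lt_pow_self (by omega : 1 < p)).le⟩
  obtain ⟨K, hK3, hKmin⟩ : ∃ K : ℕ, 3 * N ≤ p ^ K ∧ ∀ K' < K, ¬ 3 * N ≤ p ^ K' :=
    ⟨Nat.find hex, Nat.find_spec hex, fun K' hK' => Nat.find_min hex hK'⟩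
  have hKpos : 0 < K := by
    rw [Nat.pos_iff_ne_zero]
    rintro rfl
    rw [pow_zero] at hK3
    omega
  have hKlt : p ^ K < 3 * p * N := by
    have h := hKmin (K - 1) (by omega)
    rw [not_le] at h
    have hp0 : 0 < p := by omega
    calc p ^ K = p * p ^ (K - 1) := by rw [← pow_succ']; congr 1; omega
      _ < p * (3 * N) := Nat.mul_lt_mul_of_pos_left h hp0
      _ = 3 * p * N := by ring
  -- the coding of residues by `K` digits
  set c : ZMod N → Fin K → Fin p := fun s => digits p K ((s.val : ℕ) : ZMod (p ^ K)) with hcdef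
  have hc : ∀ s, digitValue (c s) = s.val := fun s => by
    rw [hcdef, digitValue_digits]
    exact ZMod.val_cast_of_lt (lt_of_lt_of_le (ZMod.val_lt s) (by omega))
  have hcinj : Function.Injective c := fun s s' h =>
    ZMod.val_injective N (by rw [← hc s, ← hc s', h])
  -- regularity of the block-tensor languages
  have hreg : ∀ D : Fin n → Finset (ZMod N),
      ({z : List (Fin n × Fin p) | ∃ i s, s ∈ D i ∧ z = List.ofFn (fun j : Fin K => (i, c s j))}∗ :
        Language (Fin n × Fin p)).IsRegular :=
    fun D => isRegular_kstar_of_length_eq hKpos (length_eq_of_mem_blockWords c D)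
  refine ⟨Fin n, inferInstance,
    ({z : List (Fin n × Fin p) | ∃ i s, s ∈ A i ∧ z = List.ofFn (fun j : Fin K => (i, c s j))}∗ :
      Language (Fin n × Fin p)),
    ({z : List (Fin n × Fin p) | ∃ i s, s ∈ B i ∧ z = List.ofFn (fun j : Fin K => (i, c s j))}∗ :
      Language (Fin n × Fin p)),
    ({z : List (Fin n × Fin p) | ∃ i s, s ∈ C i ∧ z = List.ofFn (fun j : Fin K => (i, c s j))}∗ :
      Language (Fin n × Fin p)),
    hreg A, hreg B, hreg C, ?_, ?_⟩
  · -- (i) STPP at every scale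
    intro k
    exact addSimultaneousTPP_automaticBlock_blockLang hKpos hK3 c hc A B C hS k
  · -- (ii) the packing sum beats `p ^ k` at every scale `k = (k₀ + 1) K`
    intro k₀
    refine ⟨(k₀ + 1) * K, ?_, ?_⟩
    · show k₀ ≤ (k₀ + 1) * K
      nlinarith
    · have hSpos : ((p : ℝ) ^ K) < ∑ i, (((A i).card * (B i).card * (C i).card : ℕ) : ℝ) ^ τ :=
        lt_trans (by exact_mod_cast hKlt) hsum
      calc (p : ℝ) ^ ((k₀ + 1) * K) = ((p : ℝ) ^ K) ^ (k₀ + 1) := by rw [pow_mul']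
        _ < (∑ i, (((A i).card * (B i).card * (C i).card : ℕ) : ℝ) ^ τ) ^ (k₀ + 1) :=
            pow_lt_pow_left₀ hSpos (by positivity) (Nat.succ_ne_zero _)
        _ ≤ _ := pow_sum_rpow_le_sum_automaticBlock_blockLang hKpos hcinj A B C τ (k₀ + 1)

end Summit.MatrixMultiplication.MatrixMultiplication.Theorems
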